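import Literature.RepresentationTheory.CompactGroups.WeylIntegrationAdAction
import Literature.LinearAlgebra.Matrix.UnitaryGroupConjugacyClasses
import Literature.MathematicalPhysics.QuantumFieldTheory.ConstructiveQFTWave0
import Mathlib.MeasureTheory.Integral.IntervalIntegral.Periodic
import Mathlib.Analysis.SpecialFunctions.Complex.Circle

/-!
# Weyl's integral formula for `U(n)`, file 6: the torus side — Haar measure of `Δ(n)` in angle coordinates, and
# the Vandermonde weight `Π_i Π_{j≠i}|t_i − t_j| = Π_{j≺k}|e^{iθ_j} − e^{iθ_k}|² = Π_jΠ_k sinc((θ_j−θ_k)/2)·Π_{j≺k}(θ_j−θ_k)²`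

statement-level skeleton of published theorems with citation tags; proofs where landed; nothing here is a claim
about the Yang–Mills mass gap

Mega-formalization `lit-balaban` (HOME `run/shared/lean/pub/lit-balaban/`), unit `lit-balaban-p28` gen 15 (Phase-2 proof
seat, free-target protocol G.5-34(d)): FILE 6 of the discharge of the tree's named fact
`Literature.RepresentationTheory.CompactGroups.weylIntegralFormula_unitary` ([BtD] IV (1.11), `G = U(n)`).
* §1 THE ANGLE PARAMETRISATION `torusPt θ = diag(e^{iθ_1}, …, e^{iθ_n}) ∈ Δ(n)` ([BtD] IV (3.1): `Δ(n) ≅ U(1)ⁿ`,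
  `ℝ/ℤ ≅ U(1)`), and **`lintegral_haarProbability_diagonalTorus_eq`: `∫_{Δ(n)} f dt = (2π)^{−n} ∫_{(−π,π]ⁿ} f(diag e^{iθ}) dθ`**
  — the normalised invariant integral of the torus ([BtD] I (5.11)/(5.13)) in coordinates: the pushforward of Lebesgue
  measure on `(ℝ/2πℤ)ⁿ` (Mathlib's `AddCircle`) under the continuous surjective homomorphism `x ↦ diag(e^{ix})` is left
  invariant, hence Haar (uniqueness, `Measure.haarMeasure_unique`), and `(−π, π]ⁿ` is a fundamental domain
  (`AddCircle.measurePreserving_mk`).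
* §2 THE WEIGHT: `Π_i Π_{j≠i} |t_ii − t_jj| = Π_{j≺k} |e^{iθ_j} − e^{iθ_k}|²` at `t = diag(e^{iθ})` — the factor
  `det(E − Ad_{G/T}(t⁻¹)) = Π_{μ≠ν}|t_μ − t_ν|` of (1.11) for `U(n)` (roots `ϑ_μ − ϑ_ν`, [BtD] V (6.2)(i)) — and the
  trigonometric identity `Π_jΠ_k sinc((θ_j − θ_k)/2) · Π_{j≺k}(θ_j − θ_k)² = Π_{j≺k}|e^{iθ_j} − e^{iθ_k}|²` linking it to
  the exponential-chart density of gen 13 (`|e^{ia} − e^{ib}| = 2|sin((a−b)/2)|`, `x·sinc x = sin x`).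

0 named facts, 0 sorry.

## References
* Th. Bröcker, T. tom Dieck, *Representations of Compact Lie Groups*, GTM 98 (1985), Ch. I (5.11)–(5.13) p. 45,
  Ch. IV (1.11) p. 163, (3.1) p. 170, Ch. V (6.2)(i) p. 209 (held: `book:brockernd-representations-compact-lie-groups`,
  p0153, p0160). [BrockerTomDieck1985]
-/

noncomputable section

open Complex Matrix MeasureTheory Set Real
open scoped ComplexConjugate ENNReal Matrix.Norms.L2Operator

namespace Literature.RepresentationTheory.CompactGroups.WeylIntegration

open Literature.LinearAlgebra.Matrix (diagonalTorus diagonalTorusHom coe_diagonalTorusHom_apply range_diagonalTorusHom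
  continuous_diagonalTorusHom)
open Literature.MathematicalPhysics.QuantumFieldTheory (haarProbability)

variable {n : Type*} [Fintype n] [DecidableEq n]

/-! ## §1 Haar measure of `Δ(n)` in angle coordinates -/

/-- THE ANGLE PARAMETRISATION of the diagonal torus: `torusPt θ = diag(e^{iθ_1}, …, e^{iθ_n}) ∈ Δ(n)`.
[cite: BrockerTomDieck1985, IV (3.1) p0160] -/
def torusPt (θ : n → ℝ) : diagonalTorus n :=
  ⟨diagonalTorusHom n fun j => Circle.exp (θ j), by rw [← range_diagonalTorusHom]; exact ⟨_, rfl⟩⟩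

/-- The matrix of `torusPt θ` is `diag(e^{iθ_j})`. [cite: BrockerTomDieck1985, IV (3.1) p0160] -/
@[simp] theorem coe_torusPt (θ : n → ℝ) :
    (((torusPt θ : diagonalTorus n) : Matrix.unitaryGroup n ℂ) : Matrix n n ℂ) = diagonal fun j => cexp (θ j * I) := by
  simp [torusPt, coe_diagonalTorusHom_apply, Circle.coe_exp]

omit [DecidableEq n] in
/-- The cube `(−π, π]ⁿ` is measurable. [cite: BrockerTomDieck1985, I (5.13) p0045] -/
theorem measurableSet_angleCube : MeasurableSet (Set.pi Set.univ fun _ : n => Set.Ioc (-π) π) :=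
  MeasurableSet.univ_pi fun _ => measurableSet_Ioc

/-- `torusPt` is continuous. [cite: BrockerTomDieck1985, IV (3.1) p0160] -/
theorem continuous_torusPt : Continuous (torusPt (n := n)) :=
  ((continuous_diagonalTorusHom n).comp (continuous_pi fun j => Circle.exp.continuous.comp (continuous_apply j))).subtype_mk _

/-- `torusPt` is measurable. [cite: BrockerTomDieck1985, IV (3.1) p0160] -/
theorem measurable_torusPt : Measurable (torusPt (n := n)) := continuous_torusPt.measurable

/-- **HAAR MEASURE OF `Δ(n)` IN ANGLE COORDINATES**: for measurable `f ≥ 0` on the diagonal torus,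
`∫_{Δ(n)} f d(Haar prob.) = (2π)^{−n} ∫_{θ ∈ (−π,π]ⁿ} f(diag e^{iθ}) dθ` (the normalised invariant integral of the torus
`Δ(n) ≅ (ℝ/2πℤ)ⁿ`: the image of Lebesgue measure under `x ↦ diag(e^{ix})` is left invariant, hence Haar by uniqueness;
`(−π, π]` is a fundamental domain of `ℝ/2πℤ`). [cite: BrockerTomDieck1985, I (5.13) p0045] [cite: BrockerTomDieck1985, IV (3.1) p0160] -/
theorem lintegral_haarProbability_diagonalTorus_eq {f : diagonalTorus n → ℝ≥0∞} (hf : Measurable f) :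
    ∫⁻ t, f t ∂haarProbability (diagonalTorus n) =
      (ENNReal.ofReal (2 * π) ^ Fintype.card n)⁻¹ *
        ∫⁻ θ in Set.pi Set.univ (fun _ : n => Set.Ioc (-π) π), f (torusPt θ) := by
  haveI : Fact (0 < 2 * π) := ⟨Real.two_pi_pos⟩
  -- the parametrisation by the additive torus `(ℝ/2πℤ)ⁿ`
  let E : (n → AddCircle (2 * π)) → diagonalTorus n := fun x =>
    ⟨diagonalTorusHom n fun j => (x j).toCircle, by rw [← range_diagonalTorusHom]; exact ⟨_, rfl⟩⟩
  have hEc : Continuous E := ((continuous_diagonalTorusHom n).comp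
    (continuous_pi fun j => AddCircle.continuous_toCircle.comp (continuous_apply j))).subtype_mk _
  have hEm : Measurable E := hEc.measurable
  have hEmul : ∀ x y, E (x + y) = E x * E y := by
    intro x y
    apply Subtype.ext
    change diagonalTorusHom n _ = diagonalTorusHom n _ * diagonalTorusHom n _
    rw [← map_mul]
    congr 1
    funext j
    exact AddCircle.toCircle_add _ _
  have hEsurj : Function.Surjective E := by
    rintro ⟨t, ht⟩
    rw [← range_diagonalTorusHom] at ht
    obtain ⟨z, rfl⟩ := ht
    refine ⟨fun j => (AddCircle.homeomorphCircle (T := 2 * π) Real.two_pi_pos.ne').symm (z j), Subtype.ext ?_⟩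
    change diagonalTorusHom n _ = diagonalTorusHom n z
    congr 1
    funext j
    rw [← AddCircle.homeomorphCircle_apply Real.two_pi_pos.ne', Homeomorph.apply_symm_apply]
  have hEmk : ∀ θ : n → ℝ, E (fun j => ((θ j : ℝ) : AddCircle (2 * π))) = torusPt θ := by
    intro θ
    apply Subtype.ext
    change diagonalTorusHom n _ = diagonalTorusHom n _
    congr 1
    funext j
    rw [AddCircle.toCircle_apply_mk, div_self Real.two_pi_pos.ne', one_mul]
  -- the image measure is left invariant, hence a multiple of Haar
  set ν : Measure (diagonalTorus n) := Measure.map E volume with hν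
  haveI : IsFiniteMeasure ν := Measure.isFiniteMeasure_map volume E
  haveI : ν.IsMulLeftInvariant := by
    refine ⟨fun t => ?_⟩
    obtain ⟨w, rfl⟩ := hEsurj t
    rw [hν, Measure.map_map (measurable_const_mul _) hEm]
    have hcomp : (fun s => E w * s) ∘ E = E ∘ fun x => w + x := by
      funext x; simp only [Function.comp_apply, hEmul]
    rw [hcomp, ← Measure.map_map hEm (measurable_const_add w), map_add_left_eq_self]
  haveI : SecondCountableTopology (diagonalTorus n) := TopologicalSpace.Subtype.secondCountableTopology _
  have huniq := Measure.haarMeasure_unique ν ⊤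
  have hνtop : ν ((⊤ : TopologicalSpace.PositiveCompacts (diagonalTorus n)) : Set (diagonalTorus n)) =
      ENNReal.ofReal (2 * π) ^ Fintype.card n := by
    rw [TopologicalSpace.PositiveCompacts.coe_top, hν, Measure.map_apply hEm MeasurableSet.univ, Set.preimage_univ,
      volume_pi, Measure.pi_univ]
    simp [AddCircle.measure_univ]
  have hC0 : ENNReal.ofReal (2 * π) ^ Fintype.card n ≠ 0 := pow_ne_zero _ (ENNReal.ofReal_pos.2 Real.two_pi_pos).ne'
  have hCt : ENNReal.ofReal (2 * π) ^ Fintype.card n ≠ ⊤ := ENNReal.pow_ne_top ENNReal.ofReal_ne_top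
  -- `∫ f dν = (2π)^n ∫ f d(Haar prob.)`
  have h1 : ∫⁻ t, f t ∂ν = ENNReal.ofReal (2 * π) ^ Fintype.card n * ∫⁻ t, f t ∂haarProbability (diagonalTorus n) := by
    rw [huniq, hνtop, lintegral_smul_measure]
    rfl
  -- `∫ f dν = ∫_{(−π,π]ⁿ} f(torusPt θ) dθ`
  have hmp : MeasurePreserving (fun θ : n → ℝ => fun j => ((θ j : ℝ) : AddCircle (2 * π)))
      (Measure.pi fun _ : n => (volume : Measure ℝ).restrict (Set.Ioc (-π) (-π + 2 * π))) (Measure.pi fun _ => volume) :=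
    measurePreserving_pi _ _ fun j => AddCircle.measurePreserving_mk (2 * π) (-π)
  have h2 : ∫⁻ t, f t ∂ν = ∫⁻ θ in Set.pi Set.univ (fun _ : n => Set.Ioc (-π) π), f (torusPt θ) := by
    rw [hν, lintegral_map hf hEm]
    change ∫⁻ a, f (E a) ∂(Measure.pi fun _ => volume) = _
    have key := hmp.lintegral_comp (hf.comp hEm)
    simp only [Function.comp_apply, hEmk] at key
    rw [← key, show -π + 2 * π = π by ring, ← Measure.restrict_pi_pi]
    rfl
  rw [← h2, h1, ← mul_assoc, ENNReal.inv_mul_cancel hC0 hCt, one_mul]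

/-! ## §2 The Vandermonde weight at `diag(e^{iθ})` and the trigonometric identity -/

/-- **`sinc((a−b)/2) · sinc((b−a)/2) · (a−b)² = |e^{ia} − e^{ib}|²`** (`|e^{ia} − e^{ib}| = 2|sin((a−b)/2)|`).
[cite: BrockerTomDieck1985, V (6.2)(i) p0209] -/
theorem sinc_mul_sinc_mul_sub_sq (a b : ℝ) :
    Real.sinc ((a - b) / 2) * Real.sinc ((b - a) / 2) * (a - b) ^ 2 = ‖cexp (a * I) - cexp (b * I)‖ ^ 2 := by
  have hnorm : ‖cexp (a * I) - cexp (b * I)‖ = |2 * Real.sin ((a - b) / 2)| := by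
    have : cexp (a * I) - cexp (b * I) = cexp (b * I) * (cexp (I * (a - b : ℝ)) - 1) := by
      rw [mul_sub, mul_one, ← Complex.exp_add]
      congr 1
      push_cast
      ring
    rw [this, norm_mul, Complex.norm_exp_ofReal_mul_I, one_mul, Complex.norm_exp_I_mul_ofReal_sub_one,
      Real.norm_eq_abs]
  rw [hnorm, show (b - a) / 2 = -((a - b) / 2) by ring, Real.sinc_neg, sq_abs]
  set y := (a - b) / 2 with hy
  have hab : a - b = 2 * y := by rw [hy]; ring
  rw [hab]
  by_cases h : y = 0
  · rw [h, Real.sinc_zero]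
    simp
  · rw [Real.sinc_of_ne_zero h]
    field_simp

/-- **THE TRIGONOMETRIC IDENTITY** `Π_jΠ_k sinc((θ_j − θ_k)/2) · Π_{j≺k}(θ_j − θ_k)² = Π_{j≺k}|e^{iθ_j} − e^{iθ_k}|²`
(exponential-chart density × Lie-algebra Vandermonde square = group Vandermonde square).
[cite: BrockerTomDieck1985, V (6.2)(i) p0209] [cite: BrockerTomDieck1985, IV (1.11) p0153] -/
theorem prod_sinc_mul_prod_sub_sq (θ : n → ℝ) :
    (∏ j, ∏ k, Real.sinc ((θ j - θ k) / 2)) * ∏ p : OD n, (θ p.1.1 - θ p.1.2) ^ 2 =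
      ∏ p : OD n, ‖cexp (θ p.1.1 * I) - cexp (θ p.1.2 * I)‖ ^ 2 := by
  have h1 : ∏ j, ∏ k, Real.sinc ((θ j - θ k) / 2) = ∏ j, ∏ k ∈ Finset.univ.erase j, Real.sinc ((θ j - θ k) / 2) := by
    refine Finset.prod_congr rfl fun j _ => ?_
    rw [← Finset.mul_prod_erase _ _ (Finset.mem_univ j), sub_self, zero_div, Real.sinc_zero, one_mul]
  rw [h1, prod_offDiag_eq_prod_OD (fun j k => Real.sinc ((θ j - θ k) / 2)), ← Finset.prod_mul_distrib]
  exact Finset.prod_congr rfl fun p _ => sinc_mul_sinc_mul_sub_sq _ _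

/-- **THE WEIGHT OF (1.11) AT `diag(e^{iθ})`**: `Π_i Π_{j≠i} |t_ii − t_jj| = Π_{j≺k} |e^{iθ_j} − e^{iθ_k}|²` for
`t = torusPt θ`. [cite: BrockerTomDieck1985, IV (1.11) p0153] [cite: BrockerTomDieck1985, V (6.2)(i) p0209] -/
theorem prod_offDiag_norm_sub_torusPt (θ : n → ℝ) :
    ∏ i, ∏ j ∈ Finset.univ.erase i,
        ‖(((torusPt θ : diagonalTorus n) : Matrix.unitaryGroup n ℂ) : Matrix n n ℂ) i i -
          (((torusPt θ : diagonalTorus n) : Matrix.unitaryGroup n ℂ) : Matrix n n ℂ) j j‖ =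
      ∏ p : OD n, ‖cexp (θ p.1.1 * I) - cexp (θ p.1.2 * I)‖ ^ 2 := by
  simp only [coe_torusPt, diagonal_apply_eq]
  rw [prod_offDiag_eq_prod_OD]
  refine Finset.prod_congr rfl fun p _ => ?_
  rw [norm_sub_rev (cexp (θ p.1.2 * I)), sq]

/-- The weight is continuous on the torus. [cite: BrockerTomDieck1985, IV (1.11) p0153] -/
theorem continuous_torusWeight :
    Continuous fun t : diagonalTorus n => ∏ i, ∏ j ∈ Finset.univ.erase i,
      ‖((t : Matrix.unitaryGroup n ℂ) : Matrix n n ℂ) i i - ((t : Matrix.unitaryGroup n ℂ) : Matrix n n ℂ) j j‖ := by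
  have hc : Continuous fun t : diagonalTorus n => ((t : Matrix.unitaryGroup n ℂ) : Matrix n n ℂ) :=
    continuous_subtype_val.comp continuous_subtype_val
  refine continuous_finsetProd _ fun i _ => continuous_finsetProd _ fun j _ => ?_
  exact ((hc.matrix_elem i i).sub (hc.matrix_elem j j)).norm

end Literature.RepresentationTheory.CompactGroups.WeylIntegration
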